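import Mathlib.Analysis.Convex.SpecificFunctions.Basic
import Mathlib.Analysis.SpecialFunctions.Pow.Asymptotics
import Literature.Probability.LatticeModels.CriticalEtaUpperDCP
import Literature.Probability.LatticeModels.CriticalTwoPointDCPLower
import Literature.Probability.LatticeModels.CriticalTwoPointBounds
import Literature.Probability.LatticeModels.CorrelationDecayProofs
import HarnessLib

/-!
# `η ≤ 1/2` on `ℤ³` from the axial lower bound: the printed proof of
# Duminil-Copin–Panis 2025, Theorem 1.5

Sibling proof file of `CriticalEtaUpperDCP.lean` (home of the named fact `dcp_isingEta_le_half`,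
D-0014). Theorem-only: no definition, no named fact.

H. Duminil-Copin, R. Panis, *New lower bounds for the (near) critical Ising and φ⁴ models'
two-point functions*, CMP 406 (2025) = arXiv:2404.05700, Theorem 1.5 (arXiv p. 6): "Let `d = 3`.
If the critical exponent `η` exists, it satisfies `η ≤ 1/2`. *Proof.* The proof follows by
plugging the estimate provided by the existence of `η` in (1.9)" — (1.9) being Theorem 1.3,
`⟨τ₀τ_{ne₁}⟩_{β_c} ≥ c₁ / (χ_{4n}(β_c) + n^{d-2} Σ_{1 ≤ k ≤ 2n} k⟨τ₀τ_{ke₁}⟩_{β_c})` (`n ≥ N₁`), the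
named fact `dcp_criticalTwoPoint_axis_lower` of `CriticalTwoPointDCPLower.lean`. This file proves
exactly that printed implication,

* `dcp_isingEta_le_half_of_axis_lower : dcp_criticalTwoPoint_axis_lower (d := 3) → dcp_isingEta_le_half`,

reducing Thm. 1.5 to Thm. 1.3 (whose own printed proof rests on the reflected-random-current
inequality Thm. 1.2, `dcp_reflectedGradient_lower`); `dcp_isingEta_le_half_holds` is then one line.

The argument, with the source's `o(1)` made explicit. `G = ⟨σ₀σ_x⟩_{β_c}` on `ℤ³` (free state =
plus state at `β_c`, `twoPointPlus_criticalBeta_eq_twoPointFree_holds`), `log G(x)/log ‖x‖ → -(1+η)`.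
Suppose `η > 1/2`. (1) `η ≤ 1` from Simon's bound `c‖x‖^{-2} ≤ G` (`criticalTwoPoint_bounds_holds`,
`HasSpatialDecayExponent.le_of_lower_bound`). (2) With `b := (2η+1)/4 ∈ (1/2, 3/4]`, i.e.
`ε := η - b > 0`: `G(x) ≤ K‖x‖^{-(1+b)}` for all `x ≠ 0` (`….exists_le_mul_rpow`). (3) Hence
`χ_{4n} ≤ 1 + 864K n^{2-b}` (shells `|∂Λ_m| ≤ 54m²`, `sum_box_erase_norm_rpow_le`) and
`Σ_{k≤2n} kG(ke₁) ≤ 8K n^{1-b}` (`Σ_{k≤N} k^{p-1} ≤ N^p/p`, `sum_Icc_rpow_sub_one_le`, Bernoulli), so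
the denominator of (1.9) is `≤ (1+872K) n^{2-b}` (`dcp_denominator_le`). (4) (1.9) and (2) at
`ne₁`: `0 < c₁ ≤ (1+872K)K n^{1-2b} → 0` since `1 - 2b = (1-2η)/2 < 0` — contradiction.

## References

* H. Duminil-Copin, R. Panis, CMP 406 (2025), arXiv:2404.05700, Theorem 1.5 and its proof (p. 6),
  Theorem 1.3 (p. 5) [DuminilCopinPanis2025LowerBounds].
-/

noncomputable section

open Filter Finset
open _root_.Topology

namespace Literature.Probability.LatticeModels

/-! ### Two elementary facts about logarithmic decay exponents -/

/-- A pointwise power lower bound caps the logarithmic decay exponent: if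
`log G(x) / log ‖x‖ → -κ` along `cofinite` on `ℤ^d` (`d ≥ 1`) and `c‖x‖^{-s} ≤ G(x)` for all
`x ≠ 0` with `c > 0`, then `κ ≤ s`. (Squeeze `log c / log ‖x‖ - s ≤ log G(x)/log ‖x‖` and pass to
the limit.) Elementary; this is how `η ≤ 1` is read off Simon's bound in Duminil-Copin–Panis 2025,
§1, after (1.2). [cite: DuminilCopinPanis2025LowerBounds, §1, discussion after eq. (1.2)] -/
theorem HasSpatialDecayExponent.le_of_lower_bound {d : ℕ} [NeZero d] {G : Site d → ℝ}
    {κ c s : ℝ} (h : HasSpatialDecayExponent G κ) (hc : 0 < c)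
    (hlow : ∀ x : Site d, x ≠ 0 → c * ‖x‖ ^ (-s) ≤ G x) : κ ≤ s := by
  have hlog : Tendsto (fun x : Site d => Real.log ‖x‖) cofinite atTop :=
    Real.tendsto_log_atTop.comp Site.tendsto_norm_cofinite_atTop
  have hlow' : Tendsto (fun x : Site d => Real.log c / Real.log ‖x‖ + (-s)) cofinite (𝓝 (-s)) := by
    simpa using (hlog.const_div_atTop (Real.log c)).add_const (-s)
  have hle : ∀ᶠ x : Site d in cofinite,
      Real.log c / Real.log ‖x‖ + (-s) ≤ Real.log (G x) / Real.log ‖x‖ := by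
    filter_upwards [Site.tendsto_norm_cofinite_atTop.eventually_gt_atTop 1] with x hx
    have hx0 : x ≠ 0 := by
      rintro rfl
      simp at hx
      linarith
    have hxpos : 0 < ‖x‖ := by linarith
    have hlogx : 0 < Real.log ‖x‖ := Real.log_pos hx
    have hpos : 0 < (‖x‖ : ℝ) ^ (-s) := Real.rpow_pos_of_pos hxpos _
    have h1 : Real.log c + (-s) * Real.log ‖x‖ ≤ Real.log (G x) := by
      rw [← Real.log_rpow hxpos, ← Real.log_mul hc.ne' hpos.ne']
      exact Real.log_le_log (mul_pos hc hpos) (hlow x hx0)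
    rw [div_add' _ _ _ hlogx.ne', div_le_div_iff_of_pos_right hlogx]
    linarith
  have := le_of_tendsto_of_tendsto hlow' h hle
  linarith

/-- From a logarithmic decay exponent to a power upper bound with an `ε`-loss: if
`log G(x) / log ‖x‖ → -κ` along `cofinite` on `ℤ^d` then for every `ε > 0` there is `K > 0` with
`G(x) ≤ K ‖x‖^{-κ+ε}` for ALL `x ≠ 0` (eventually `G(x) ≤ ‖x‖^{-κ+ε}`; the finitely many
exceptional sites are absorbed into `K`). This is the upper half of "the estimate provided by the
existence of `η`", `⟨τ₀τ_x⟩_{β_c} = |x|^{-(d-2+η-o(1))}` (Duminil-Copin–Panis 2025, eq. (1.3)),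
in usable form. Elementary. [cite: DuminilCopinPanis2025LowerBounds, eq. (1.3) and proof of Theorem 1.5] -/
theorem HasSpatialDecayExponent.exists_le_mul_rpow {d : ℕ} {G : Site d → ℝ} {κ : ℝ}
    (h : HasSpatialDecayExponent G κ) {ε : ℝ} (hε : 0 < ε) :
    ∃ K : ℝ, 0 < K ∧ ∀ x : Site d, x ≠ 0 → G x ≤ K * ‖x‖ ^ (-κ + ε) := by
  -- eventually the clean bound `G x ≤ ‖x‖^{-κ+ε}`
  have hev : ∀ᶠ x : Site d in cofinite, G x ≤ ‖x‖ ^ (-κ + ε) := by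
    have h1 : ∀ᶠ x : Site d in cofinite, Real.log (G x) / Real.log ‖x‖ < -κ + ε :=
      h.eventually (Iio_mem_nhds (by linarith))
    filter_upwards [h1, Site.tendsto_norm_cofinite_atTop.eventually_gt_atTop 1] with x hx hx1
    have hxpos : 0 < ‖x‖ := by linarith
    have hlogx : 0 < Real.log ‖x‖ := Real.log_pos hx1
    by_cases hG : G x ≤ 0
    · exact hG.trans (Real.rpow_nonneg hxpos.le _)
    push Not at hG
    have h2 : Real.log (G x) < (-κ + ε) * Real.log ‖x‖ := (div_lt_iff₀ hlogx).1 hx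
    have h3 : Real.log (G x) ≤ Real.log (‖x‖ ^ (-κ + ε)) := by
      rw [Real.log_rpow hxpos]
      exact h2.le
    exact (Real.log_le_log_iff hG (Real.rpow_pos_of_pos hxpos _)).1 h3
  -- the finite exceptional set
  obtain ⟨E, hE⟩ : ∃ E : Finset (Site d), ∀ x, x ∉ E → G x ≤ ‖x‖ ^ (-κ + ε) := by
    have hfin := Filter.eventually_cofinite.1 hev
    exact ⟨hfin.toFinset, fun x hx => by
      by_contra hcon
      exact hx (hfin.mem_toFinset.2 hcon)⟩
  have hnn : ∀ y ∈ E, 0 ≤ |G y| * ‖y‖ ^ (κ - ε) :=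
    fun y _ => mul_nonneg (abs_nonneg _) (Real.rpow_nonneg (norm_nonneg _) _)
  have hsum : 0 ≤ ∑ y ∈ E, |G y| * ‖y‖ ^ (κ - ε) := Finset.sum_nonneg hnn
  refine ⟨1 + ∑ y ∈ E, |G y| * ‖y‖ ^ (κ - ε), by linarith, fun x hx0 => ?_⟩
  have hxpos : 0 < ‖x‖ := norm_pos_iff.2 hx0
  have hrnn : 0 ≤ ‖x‖ ^ (-κ + ε) := Real.rpow_nonneg hxpos.le _
  by_cases hxE : x ∈ E
  · have h1 : G x ≤ |G x| * ‖x‖ ^ (κ - ε) * ‖x‖ ^ (-κ + ε) := by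
      rw [mul_assoc, ← Real.rpow_add hxpos, show κ - ε + (-κ + ε) = 0 by ring, Real.rpow_zero,
        mul_one]
      exact le_abs_self _
    have h2 : |G x| * ‖x‖ ^ (κ - ε) ≤ ∑ y ∈ E, |G y| * ‖y‖ ^ (κ - ε) :=
      Finset.single_le_sum hnn hxE
    calc G x ≤ |G x| * ‖x‖ ^ (κ - ε) * ‖x‖ ^ (-κ + ε) := h1
      _ ≤ (∑ y ∈ E, |G y| * ‖y‖ ^ (κ - ε)) * ‖x‖ ^ (-κ + ε) :=
          mul_le_mul_of_nonneg_right h2 hrnn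
      _ ≤ (1 + ∑ y ∈ E, |G y| * ‖y‖ ^ (κ - ε)) * ‖x‖ ^ (-κ + ε) :=
          mul_le_mul_of_nonneg_right (by linarith) hrnn
  · calc G x ≤ ‖x‖ ^ (-κ + ε) := hE x hxE
      _ = 1 * ‖x‖ ^ (-κ + ε) := (one_mul _).symm
      _ ≤ (1 + ∑ y ∈ E, |G y| * ‖y‖ ^ (κ - ε)) * ‖x‖ ^ (-κ + ε) :=
          mul_le_mul_of_nonneg_right (by linarith) hrnn

/-! ### Two lattice-sum estimates on `ℤ³` -/

/-- Shell estimate on `ℤ³`: `Σ_{x ∈ Λ_N ∖ {0}} ‖x‖_∞^{-a} ≤ 54 Σ_{m < N} (m+1)^{2-a}`, from the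
shell count `|∂Λ_{m+1}| = (2m+3)³ - (2m+1)³ ≤ 6(2m+3)² ≤ 54(m+1)²` (`card_sphere_succ_le`).
The counting behind "`χ_{4n}(β_c) = n^{2-η+o(1)}`" in the proof of Duminil-Copin–Panis 2025,
Thm. 1.5. Elementary. [folklore] -/
theorem sum_box_erase_norm_rpow_le (a : ℝ) (N : ℕ) :
    ∑ x ∈ (box 3 N).erase 0, ‖x‖ ^ (-a) ≤
      54 * ∑ m ∈ Finset.range N, ((m : ℝ) + 1) ^ (2 - a) := by
  induction N with
  | zero =>
    have h0 : ∀ x, x ∉ (box 3 0).erase (0 : Site 3) := by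
      intro x hx
      rw [Finset.mem_erase, mem_box_iff_supNorm_le, Nat.le_zero, Site.supNorm_eq_zero_iff] at hx
      exact hx.1 hx.2
    rw [Finset.eq_empty_of_forall_notMem h0]
    simp
  | succ N ih =>
    have hsplit : (box 3 (N + 1)).erase (0 : Site 3) = (box 3 N).erase 0 ∪ sphere 3 (N + 1) := by
      rw [sphere_succ_eq_sdiff]
      ext m
      simp only [Finset.mem_erase, Finset.mem_union, Finset.mem_sdiff]
      have h0 : (0 : Site 3) ∈ box 3 N := zero_mem_box _ _
      have hsub : m ∈ box 3 N → m ∈ box 3 (N + 1) := fun h => box_mono _ (Nat.le_succ N) h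
      by_cases hm : m ∈ box 3 N
      · simp [hm, hsub hm]
      · simp only [hm, not_false_eq_true, and_true, and_false, false_or]
        constructor
        · exact fun h => h.2
        · intro h
          exact ⟨fun h' => hm (h' ▸ h0), h⟩
    have hdisj : Disjoint ((box 3 N).erase 0) (sphere 3 (N + 1)) := by
      rw [sphere_succ_eq_sdiff, Finset.disjoint_left]
      intro m hm hm'
      exact (Finset.mem_sdiff.1 hm').2 (Finset.mem_of_mem_erase hm)
    have hshell : ∑ x ∈ sphere 3 (N + 1), ‖x‖ ^ (-a) ≤ 54 * ((N : ℝ) + 1) ^ (2 - a) := by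
      have hcongr : ∀ x ∈ sphere 3 (N + 1), ‖x‖ ^ (-a) = ((N : ℝ) + 1) ^ (-a) := by
        intro x hx
        rw [Site.norm_eq_supNorm, mem_sphere.1 hx]
        push_cast
        ring
      rw [Finset.sum_congr rfl hcongr, Finset.sum_const, nsmul_eq_mul]
      have hcard := card_sphere_succ_le (d := 3) N
      norm_num at hcard
      have hN1 : (0 : ℝ) < (N : ℝ) + 1 := by positivity
      have h9 : (2 * (N : ℝ) + 3) ^ 2 ≤ 9 * ((N : ℝ) + 1) ^ 2 := by nlinarith
      have hc54 : (#(sphere 3 (N + 1)) : ℝ) ≤ 54 * ((N : ℝ) + 1) ^ 2 := by nlinarith [hcard, h9]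
      calc (#(sphere 3 (N + 1)) : ℝ) * ((N : ℝ) + 1) ^ (-a)
          ≤ 54 * ((N : ℝ) + 1) ^ 2 * ((N : ℝ) + 1) ^ (-a) :=
            mul_le_mul_of_nonneg_right hc54 (Real.rpow_nonneg hN1.le _)
        _ = 54 * ((N : ℝ) + 1) ^ (2 - a) := by
            rw [sub_eq_add_neg, Real.rpow_add hN1, Real.rpow_two]
            ring
    rw [hsplit, Finset.sum_union hdisj, Finset.sum_range_succ, mul_add]
    exact add_le_add ih hshell

/-- `Σ_{k=1}^{N} k^{p-1} ≤ N^p / p` for `0 < p ≤ 1` (induction on `N`; the step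
`N^p + p(N+1)^{p-1} ≤ (N+1)^p` is Bernoulli's inequality `(1 - 1/(N+1))^p ≤ 1 - p/(N+1)`,
Mathlib's `rpow_one_add_le_one_add_mul_self`). The counting behind
"`n^{d-2} Σ_{k ≤ 2n} k⟨τ₀τ_{ke₁}⟩_{β_c} = n^{2-η+o(1)}`" in the proof of Duminil-Copin–Panis 2025,
Thm. 1.5. Elementary. [folklore] -/
theorem sum_Icc_rpow_sub_one_le {p : ℝ} (hp0 : 0 < p) (hp1 : p ≤ 1) (N : ℕ) :
    ∑ k ∈ Finset.Icc 1 N, (k : ℝ) ^ (p - 1) ≤ (N : ℝ) ^ p / p := by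
  induction N with
  | zero =>
    rw [Finset.Icc_eq_empty (by omega), Finset.sum_empty]
    simp [Real.zero_rpow hp0.ne']
  | succ N ih =>
    rw [Finset.sum_Icc_succ_top (by omega)]
    have hN0 : (0 : ℝ) ≤ N := Nat.cast_nonneg N
    have hN1 : (0 : ℝ) < (N : ℝ) + 1 := by positivity
    have hpow : 0 < ((N : ℝ) + 1) ^ p := Real.rpow_pos_of_pos hN1 _
    -- Bernoulli: `(N/(N+1))^p ≤ 1 - p/(N+1)`
    have hs : (-1 : ℝ) ≤ -1 / ((N : ℝ) + 1) := by
      rw [neg_div, neg_le_neg_iff]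
      exact (div_le_one hN1).2 (by linarith)
    have hB := rpow_one_add_le_one_add_mul_self hs hp0.le hp1
    have h1 : (1 : ℝ) + -1 / ((N : ℝ) + 1) = (N : ℝ) / ((N : ℝ) + 1) := by
      field_simp
      ring
    rw [h1, Real.div_rpow hN0 hN1.le, div_le_iff₀ hpow] at hB
    have key : (N : ℝ) ^ p ≤ ((N : ℝ) + 1) ^ p - p * ((N : ℝ) + 1) ^ (p - 1) := by
      rw [Real.rpow_sub_one hN1.ne']
      calc (N : ℝ) ^ p ≤ (1 + p * (-1 / ((N : ℝ) + 1))) * ((N : ℝ) + 1) ^ p := hB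
        _ = ((N : ℝ) + 1) ^ p - p * (((N : ℝ) + 1) ^ p / ((N : ℝ) + 1)) := by
            field_simp
            ring
    push_cast
    calc ∑ k ∈ Finset.Icc 1 N, (k : ℝ) ^ (p - 1) + ((N : ℝ) + 1) ^ (p - 1)
        ≤ (N : ℝ) ^ p / p + ((N : ℝ) + 1) ^ (p - 1) := add_le_add ih le_rfl
      _ ≤ ((N : ℝ) + 1) ^ p / p := by
          rw [div_add' _ _ _ hp0.ne', div_le_div_iff_of_pos_right hp0]
          linarith

/-! ### The denominator of (1.9) under a power upper bound -/

/-- The denominator of Duminil-Copin–Panis 2025, (1.9), at `d = 3` is positive (indeed `≥ 1`) for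
a nonnegative `F` with `F(0) = 1` (the term `x = 0` of `χ_{4n}`). Elementary. [cite: DuminilCopinPanis2025LowerBounds, Theorem 1.3 (the denominator of (1.9))] -/
theorem dcp_denominator_pos {F : Site 3 → ℝ} (hF0 : F 0 = 1) (hFnn : ∀ x, 0 ≤ F x) (i : Fin 3)
    (n : ℕ) :
    0 < (∑ x ∈ box 3 (4 * n), F x) +
      (n : ℝ) * ∑ k ∈ Finset.Icc 1 (2 * n), (k : ℝ) * F (Pi.single i (k : ℤ)) := by
  have h1 : 1 ≤ ∑ x ∈ box 3 (4 * n), F x := by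
    rw [← Finset.add_sum_erase _ _ (zero_mem_box 3 (4 * n)), hF0]
    have := Finset.sum_nonneg fun x (_ : x ∈ (box 3 (4 * n)).erase 0) => hFnn x
    linarith
  have h2 : 0 ≤ (n : ℝ) * ∑ k ∈ Finset.Icc 1 (2 * n), (k : ℝ) * F (Pi.single i (k : ℤ)) :=
    mul_nonneg (Nat.cast_nonneg n)
      (Finset.sum_nonneg fun k _ => mul_nonneg (Nat.cast_nonneg k) (hFnn _))
  linarith

/-- **The "plugging in" of the proof of Theorem 1.5, denominator side.** If `F : ℤ³ → ℝ` has
`F(0) = 1` and `F(x) ≤ K‖x‖^{-(1+b)}` for all `x ≠ 0`, with `1/2 < b ≤ 3/4`, then for `n ≥ 1`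
`Σ_{x ∈ Λ_{4n}} F(x) + n Σ_{k=1}^{2n} k F(ke_i) ≤ (1 + 872K) n^{2-b}`
(`χ_{4n} ≤ 1 + 864K n^{2-b}` by the shell estimate, `Σ k F(ke_i) ≤ 8K n^{1-b}` by
`sum_Icc_rpow_sub_one_le`). This is "`χ_{4n}(β_c) + n Σ_{k ≤ 2n} k⟨τ₀τ_{ke₁}⟩_{β_c} = n^{2-η+o(1)}`"
of Duminil-Copin–Panis 2025, proof of Thm. 1.5, made quantitative. [cite: DuminilCopinPanis2025LowerBounds, proof of Theorem 1.5] -/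
theorem dcp_denominator_le {F : Site 3 → ℝ} {K b : ℝ} (hK : 0 < K) (hb_lo : 1 / 2 < b)
    (hb_hi : b ≤ 3 / 4) (hF0 : F 0 = 1) (hFle : ∀ x, x ≠ 0 → F x ≤ K * ‖x‖ ^ (-(1 + b)))
    (i : Fin 3) {n : ℕ} (hn : 1 ≤ n) :
    (∑ x ∈ box 3 (4 * n), F x) +
        (n : ℝ) * ∑ k ∈ Finset.Icc 1 (2 * n), (k : ℝ) * F (Pi.single i (k : ℤ)) ≤
      (1 + 872 * K) * (n : ℝ) ^ (2 - b) := by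
  have ht : (1 : ℝ) ≤ n := by exact_mod_cast hn
  have htpos : (0 : ℝ) < n := by linarith
  have hsplit : (n : ℝ) ^ (2 - b) = n * (n : ℝ) ^ (1 - b) := by
    rw [show (2 : ℝ) - b = 1 + (1 - b) by ring, Real.rpow_add htpos, Real.rpow_one]
  -- (1) the box sum `χ_{4n}`
  have h1 : ∑ x ∈ box 3 (4 * n), F x ≤ 1 + 864 * K * (n : ℝ) ^ (2 - b) := by
    rw [← Finset.add_sum_erase _ _ (zero_mem_box 3 (4 * n)), hF0]
    have hA : ∑ x ∈ (box 3 (4 * n)).erase 0, F x ≤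
        K * ∑ x ∈ (box 3 (4 * n)).erase 0, ‖x‖ ^ (-(1 + b)) := by
      rw [Finset.mul_sum]
      exact Finset.sum_le_sum fun x hx => hFle x (Finset.ne_of_mem_erase hx)
    have hB := sum_box_erase_norm_rpow_le (1 + b) (4 * n)
    have hC : ∑ m ∈ Finset.range (4 * n), ((m : ℝ) + 1) ^ (2 - (1 + b)) ≤
        (4 * n : ℕ) * ((4 * n : ℕ) : ℝ) ^ (1 - b) := by
      have hle : ∀ m ∈ Finset.range (4 * n),
          ((m : ℝ) + 1) ^ (2 - (1 + b)) ≤ ((4 * n : ℕ) : ℝ) ^ (1 - b) := by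
        intro m hm
        rw [show (2 : ℝ) - (1 + b) = 1 - b by ring]
        have hm' : m + 1 ≤ 4 * n := Finset.mem_range.1 hm
        have hm'' : (m : ℝ) + 1 ≤ ((4 * n : ℕ) : ℝ) := by exact_mod_cast hm'
        exact Real.rpow_le_rpow (by positivity) hm'' (by linarith)
      calc ∑ m ∈ Finset.range (4 * n), ((m : ℝ) + 1) ^ (2 - (1 + b))
          ≤ ∑ _m ∈ Finset.range (4 * n), ((4 * n : ℕ) : ℝ) ^ (1 - b) := Finset.sum_le_sum hle
        _ = (4 * n : ℕ) * ((4 * n : ℕ) : ℝ) ^ (1 - b) := by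
            rw [Finset.sum_const, Finset.card_range, nsmul_eq_mul]
    have hD : ((4 * n : ℕ) : ℝ) * ((4 * n : ℕ) : ℝ) ^ (1 - b) ≤ 16 * (n : ℝ) ^ (2 - b) := by
      push_cast
      rw [Real.mul_rpow (by norm_num) htpos.le, hsplit]
      have h4 : (4 : ℝ) ^ (1 - b) ≤ 4 := by
        calc (4 : ℝ) ^ (1 - b) ≤ (4 : ℝ) ^ (1 : ℝ) :=
              Real.rpow_le_rpow_of_exponent_le (by norm_num) (by linarith)
          _ = 4 := Real.rpow_one 4
      have hpos : 0 ≤ (n : ℝ) * (n : ℝ) ^ (1 - b) :=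
        mul_nonneg htpos.le (Real.rpow_nonneg htpos.le _)
      calc 4 * (n : ℝ) * ((4 : ℝ) ^ (1 - b) * (n : ℝ) ^ (1 - b))
          = 4 * (4 : ℝ) ^ (1 - b) * ((n : ℝ) * (n : ℝ) ^ (1 - b)) := by ring
        _ ≤ 4 * 4 * ((n : ℝ) * (n : ℝ) ^ (1 - b)) := by gcongr
        _ = 16 * ((n : ℝ) * (n : ℝ) ^ (1 - b)) := by norm_num
    have hE : ∑ x ∈ (box 3 (4 * n)).erase 0, F x ≤ 864 * K * (n : ℝ) ^ (2 - b) := by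
      calc ∑ x ∈ (box 3 (4 * n)).erase 0, F x
          ≤ K * ∑ x ∈ (box 3 (4 * n)).erase 0, ‖x‖ ^ (-(1 + b)) := hA
        _ ≤ K * (54 * ∑ m ∈ Finset.range (4 * n), ((m : ℝ) + 1) ^ (2 - (1 + b))) :=
            mul_le_mul_of_nonneg_left hB hK.le
        _ ≤ K * (54 * ((4 * n : ℕ) * ((4 * n : ℕ) : ℝ) ^ (1 - b))) := by gcongr
        _ ≤ K * (54 * (16 * (n : ℝ) ^ (2 - b))) := by gcongr
        _ = 864 * K * (n : ℝ) ^ (2 - b) := by ring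
    linarith
  -- (2) the axis sum
  have h2 : ∑ k ∈ Finset.Icc 1 (2 * n), (k : ℝ) * F (Pi.single i (k : ℤ)) ≤
      8 * K * (n : ℝ) ^ (1 - b) := by
    have hterm : ∀ k ∈ Finset.Icc 1 (2 * n),
        (k : ℝ) * F (Pi.single i (k : ℤ)) ≤ K * (k : ℝ) ^ ((1 - b) - 1) := by
      intro k hk
      have hk1 : 1 ≤ k := (Finset.mem_Icc.1 hk).1
      have hkpos : (0 : ℝ) < k := by exact_mod_cast hk1
      have hne : (Pi.single i (k : ℤ) : Site 3) ≠ 0 := by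
        intro h
        have h0 := congr_fun h i
        simp at h0
        omega
      have hnorm : ‖(Pi.single i (k : ℤ) : Site 3)‖ = k := by
        rw [Pi.norm_single, Int.norm_natCast]
      have hFk := hFle _ hne
      rw [hnorm] at hFk
      calc (k : ℝ) * F (Pi.single i (k : ℤ)) ≤ (k : ℝ) * (K * (k : ℝ) ^ (-(1 + b))) :=
            mul_le_mul_of_nonneg_left hFk hkpos.le
        _ = K * ((k : ℝ) ^ (1 : ℝ) * (k : ℝ) ^ (-(1 + b))) := by
            rw [Real.rpow_one]
            ring
        _ = K * (k : ℝ) ^ ((1 - b) - 1) := by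
            rw [← Real.rpow_add hkpos, show (1 : ℝ) + -(1 + b) = (1 - b) - 1 by ring]
    have hx : ((2 * n : ℕ) : ℝ) ^ (1 - b) ≤ 2 * (n : ℝ) ^ (1 - b) := by
      push_cast
      rw [Real.mul_rpow (by norm_num) htpos.le]
      have h2' : (2 : ℝ) ^ (1 - b) ≤ 2 := by
        calc (2 : ℝ) ^ (1 - b) ≤ (2 : ℝ) ^ (1 : ℝ) :=
              Real.rpow_le_rpow_of_exponent_le (by norm_num) (by linarith)
          _ = 2 := Real.rpow_one 2
      exact mul_le_mul_of_nonneg_right h2' (Real.rpow_nonneg htpos.le _)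
    have hnn : 0 ≤ 2 * (n : ℝ) ^ (1 - b) := by positivity
    calc ∑ k ∈ Finset.Icc 1 (2 * n), (k : ℝ) * F (Pi.single i (k : ℤ))
        ≤ ∑ k ∈ Finset.Icc 1 (2 * n), K * (k : ℝ) ^ ((1 - b) - 1) := Finset.sum_le_sum hterm
      _ = K * ∑ k ∈ Finset.Icc 1 (2 * n), (k : ℝ) ^ ((1 - b) - 1) := by rw [Finset.mul_sum]
      _ ≤ K * (((2 * n : ℕ) : ℝ) ^ (1 - b) / (1 - b)) :=
          mul_le_mul_of_nonneg_left (sum_Icc_rpow_sub_one_le (by linarith) (by linarith) _) hK.le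
      _ ≤ K * (2 * (n : ℝ) ^ (1 - b) / (1 - b)) :=
          mul_le_mul_of_nonneg_left (div_le_div_of_nonneg_right hx (by linarith)) hK.le
      _ ≤ K * (2 * (n : ℝ) ^ (1 - b) / (1 / 4)) :=
          mul_le_mul_of_nonneg_left (div_le_div_of_nonneg_left hnn (by norm_num) (by linarith))
            hK.le
      _ = 8 * K * (n : ℝ) ^ (1 - b) := by ring
  -- (3) combine
  have hone : 1 ≤ (n : ℝ) ^ (2 - b) := Real.one_le_rpow ht (by linarith)
  calc (∑ x ∈ box 3 (4 * n), F x) +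
        (n : ℝ) * ∑ k ∈ Finset.Icc 1 (2 * n), (k : ℝ) * F (Pi.single i (k : ℤ))
      ≤ (1 + 864 * K * (n : ℝ) ^ (2 - b)) + (n : ℝ) * (8 * K * (n : ℝ) ^ (1 - b)) :=
        add_le_add h1 (mul_le_mul_of_nonneg_left h2 htpos.le)
    _ = 1 + 872 * K * (n : ℝ) ^ (2 - b) := by
        rw [hsplit]
        ring
    _ ≤ (1 + 872 * K) * (n : ℝ) ^ (2 - b) := by nlinarith

/-! ### Theorem 1.5 from Theorem 1.3 -/

/-- **Duminil-Copin–Panis 2025, Theorem 1.5, as printed: "by plugging the estimate provided by the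
existence of `η` in (1.9)".** The axial lower bound of Theorem 1.3 at `β_c` on `ℤ³`
(the named fact `dcp_criticalTwoPoint_axis_lower (d := 3)`) implies the named fact
`dcp_isingEta_le_half`: if `⟨σ₀σ_x⟩_{β_c} = ‖x‖^{-(1+η)+o(1)}` (`HasIsingExponentEta 3 η`) then
`η ≤ 1/2`. Proof (module docstring): were `η > 1/2`, with `b = (2η+1)/4` the ansatz gives
`⟨σ₀σ_x⟩_{β_c} ≤ K‖x‖^{-(1+b)}` (`x ≠ 0`), so the denominator of (1.9) is `≤ (1+872K) n^{2-b}`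
while its left side is `≤ K n^{-(1+b)}`, i.e. `0 < c₁ ≤ (1+872K)K n^{1-2b} → 0`. Uses
`μ⁺_{β_c} = μ^f_{β_c}` on pairs (`twoPointPlus_criticalBeta_eq_twoPointFree_holds`) to pass from
the tree's `criticalTwoPoint 3` to the free state of the source, and Simon's bound
(`criticalTwoPoint_bounds_holds`) for `η ≤ 1` and `⟨σ₀σ_x⟩ ≥ 0`. [cite: DuminilCopinPanis2025LowerBounds, Theorem 1.5 and its proof (arXiv p. 6)] -/
theorem dcp_isingEta_le_half_of_axis_lower
    (hX : dcp_criticalTwoPoint_axis_lower (d := 3)) : dcp_isingEta_le_half := by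
  intro η hη
  by_contra hgt
  push Not at hgt
  -- the source's two-point function is the free state; the tree's `criticalTwoPoint` is the plus
  -- state; they agree at `β_c` on `ℤ³`
  have hGeq : ∀ x, criticalTwoPoint 3 x = twoPointFree 3 (criticalBeta 3) x :=
    twoPointPlus_criticalBeta_eq_twoPointFree_holds (d := 3) (by norm_num)
  -- the ansatz, exponent `1 + η`, for the free two-point function
  have hexp : HasSpatialDecayExponent (twoPointFree 3 (criticalBeta 3)) (1 + η) := by
    have h : HasSpatialDecayExponent (criticalTwoPoint 3) (((3 : ℕ) : ℝ) - 2 + η) := hη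
    rw [show ((3 : ℕ) : ℝ) - 2 + η = 1 + η by push_cast; ring] at h
    have hfun : (fun x : Site 3 => Real.log (criticalTwoPoint 3 x) / Real.log ‖x‖) =
        fun x => Real.log (twoPointFree 3 (criticalBeta 3) x) / Real.log ‖x‖ := by
      funext x
      rw [hGeq]
    unfold HasSpatialDecayExponent at h ⊢
    rwa [hfun] at h
  -- Simon–Lieb / infrared bounds at `β_c`: `c‖x‖^{-2} ≤ G(x)` for `x ≠ 0`
  obtain ⟨c, C, hc, hbnd⟩ := criticalTwoPoint_bounds_holds (d := 3) (by norm_num)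
  have hη1 : η ≤ 1 := by
    have h2 : (1 : ℝ) + η ≤ 2 := hexp.le_of_lower_bound hc (s := 2) fun x hx => by
      have h := (hbnd x hx).1
      rw [hGeq, show -(((3 : ℕ) : ℝ) - 1) = -(2 : ℝ) by norm_num] at h
      exact h
    linarith
  have hF0 : twoPointFree 3 (criticalBeta 3) 0 = 1 := twoPointFree_zero 3 _
  have hFnn : ∀ x, 0 ≤ twoPointFree 3 (criticalBeta 3) x := by
    intro x
    by_cases hx : x = 0
    · rw [hx, hF0]
      exact zero_le_one
    · have h := (hbnd x hx).1
      rw [hGeq] at h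
      exact (mul_nonneg hc.le (Real.rpow_nonneg (norm_nonneg _) _)).trans h
  -- the parameter `b = η - ε`, `ε = (2η - 1)/4`
  set b : ℝ := (2 * η + 1) / 4 with hb_def
  have hb_lo : 1 / 2 < b := by
    rw [hb_def]
    linarith
  have hb_hi : b ≤ 3 / 4 := by
    rw [hb_def]
    linarith
  -- "the estimate provided by the existence of η": `G(x) ≤ K‖x‖^{-(1+b)}`, all `x ≠ 0`
  obtain ⟨K, hK, hFle⟩ : ∃ K : ℝ, 0 < K ∧ ∀ x : Site 3, x ≠ 0 →
      twoPointFree 3 (criticalBeta 3) x ≤ K * ‖x‖ ^ (-(1 + b)) := by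
    obtain ⟨K, hK, h⟩ := hexp.exists_le_mul_rpow (ε := η - b) (by rw [hb_def]; linarith)
    refine ⟨K, hK, fun x hx => ?_⟩
    have := h x hx
    rwa [show -(1 + η) + (η - b) = -(1 + b) by ring] at this
  -- Theorem 1.3 at `β_c`, `d = 3`
  obtain ⟨c₁, hc₁, N₁, -, hmain⟩ := hX (le_refl 3)
  -- `(1 + 872K) K n^{1-2b} → 0`
  have hlim : Tendsto (fun n : ℕ => (1 + 872 * K) * K * (n : ℝ) ^ (1 - 2 * b)) atTop (𝓝 0) := by
    have h1 : Tendsto (fun t : ℝ => t ^ (1 - 2 * b)) atTop (𝓝 0) := by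
      have := tendsto_rpow_neg_atTop (y := 2 * b - 1) (by linarith)
      simpa only [neg_sub] using this
    have h2 : Tendsto (fun n : ℕ => (n : ℝ) ^ (1 - 2 * b)) atTop (𝓝 0) :=
      h1.comp tendsto_natCast_atTop_atTop
    simpa only [mul_zero] using h2.const_mul ((1 + 872 * K) * K)
  obtain ⟨n, hnlt, hnge⟩ :=
    ((hlim.eventually (gt_mem_nhds hc₁)).and (eventually_ge_atTop (max N₁ 1))).exists
  have hnN : N₁ ≤ n := le_of_max_le_left hnge
  have hn1 : 1 ≤ n := le_of_max_le_right hnge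
  have htpos : (0 : ℝ) < n := by exact_mod_cast hn1
  -- (1.9) at this `n`
  have h13 := hmain n hnN
  rw [show (3 - 2 : ℕ) = 1 from rfl, pow_one] at h13
  -- the ansatz at `x = n e₁`
  have hne : (Pi.single (⟨0, by norm_num⟩ : Fin 3) ((n : ℕ) : ℤ) : Site 3) ≠ 0 := by
    intro h
    have h0 := congr_fun h ⟨0, by norm_num⟩
    simp at h0
    omega
  have hup : twoPointFree 3 (criticalBeta 3) (Pi.single (⟨0, by norm_num⟩ : Fin 3) ((n : ℕ) : ℤ)) ≤
      K * (n : ℝ) ^ (-(1 + b)) := by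
    have := hFle _ hne
    rwa [Pi.norm_single, Int.norm_natCast] at this
  have hDpos := dcp_denominator_pos hF0 hFnn (⟨0, by norm_num⟩ : Fin 3) n
  have hDle := dcp_denominator_le hK hb_lo hb_hi hF0 hFle (⟨0, by norm_num⟩ : Fin 3) hn1
  have hdiv := (div_le_iff₀ hDpos).1 (h13.trans hup)
  have hchain : c₁ ≤ (1 + 872 * K) * K * (n : ℝ) ^ (1 - 2 * b) := by
    calc c₁ ≤ K * (n : ℝ) ^ (-(1 + b)) * _ := hdiv
      _ ≤ K * (n : ℝ) ^ (-(1 + b)) * ((1 + 872 * K) * (n : ℝ) ^ (2 - b)) :=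
          mul_le_mul_of_nonneg_left hDle (by positivity)
      _ = (1 + 872 * K) * K * ((n : ℝ) ^ (-(1 + b)) * (n : ℝ) ^ (2 - b)) := by ring
      _ = (1 + 872 * K) * K * (n : ℝ) ^ (1 - 2 * b) := by
          rw [← Real.rpow_add htpos, show -(1 + b) + (2 - b) = 1 - 2 * b by ring]
  linarith

end Literature.Probability.LatticeModels
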